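import Literature.MathematicalPhysics.KineticTheory.HardSphereWindowPressureStatic
import Literature.MathematicalPhysics.KineticTheory.HardSphereDisplacementPathLength
import Summits.AtomisticToContinuum.HydrodynamicLimit.Theorems.AntiMazurCoboundariesInfluenceLocalityTrueCapsExistPrelimA
import Summits.AtomisticToContinuum.HydrodynamicLimit.Theorems.JParityClosureOddContactSymmetryGibbsInvariance

/-!
# Tube count: tame spheres touching a wanderer are few

Route `AntiMazurCoboundaries` of `AtomisticToContinuum/HydrodynamicLimit`, crux stmt-AtomisticToContinuum-14135
(`CorrectorPressureDecay`), line `almost-invariant-duality`, lead-held layer-2 input h₂ = within-lag SHOT-NOISE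
PRESSURE (hypothesis `h₂` of `TransferSkeleton.correctorPressureDecay_of_inputs`); registered sub-goal `snp_tubeCount`.

Along a good orbit `t ↦ Φ.flow t z` of `N` hard spheres of diameter `ε` on `𝕋³`, sphere `j` travels a path of
length `d_j = ∫₀ᴸ ‖v_j‖` during `[0, L]`. The spheres `i` of path length `≤ ε` over `[0, L]` that come into
contact with `j` (minimal-image separation exactly `ε`) at some time `t_i ∈ [0, L]` number at most
`1331 (d_j / ε + 1)` (`snp_tubeCount`, from a packing bound `hpack` for `ε`-separated points of `𝕋³` taken as a
hypothesis). Proof (bucket argument, `snp_tubeCount_of_forall`): such an `i` starts within `2ε` of the point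
`x_j(t_i)` of the path of `j` (displacement `≤` path length,
`HardSphereFlow.euclidDist_flow_le_integral_norm_vel_of_mem_Icc₂`, plus the contact); bucket the `i` by
`⌊ℓ_j(t_i) / ε⌋₊`, `ℓ_j(t) = ∫₀ᵗ ‖v_j‖ ∈ [0, d_j]`; two members of one bucket have `|ℓ_j(t_i) - ℓ_j(t_i')| < ε`,
so `dist(x_j(t_i), x_j(t_i')) ≤ |∫_{t_i'}^{t_i} ‖v_j‖| < ε` and their initial positions are within `5ε`; initial
positions are pairwise `≥ ε` apart (hard core), so a bucket has `≤ (2·5+1)³ = 1331` members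
(`Finset.card_le_mul_card_image`), and there are at most `⌊d_j/ε⌋₊ + 1 ≤ d_j/ε + 1` buckets.
-/

noncomputable section

open MeasureTheory Set Filter Topology
open scoped ENNReal Classical

namespace Summit.AtomisticToContinuum.HydrodynamicLimit.Theorems.ShotNoisePressure

open Literature.Analysis.FluidPDE
open Literature.MathematicalPhysics.KineticTheory (T3 V3 hsDiameter localGibbsLaw gaussMeasure)

/-- **Tube count, abstract form.** If every sphere `i` of a finite set `T` has path length `≤ ε` over `[0, L]`
and touches sphere `j` at some time of `[0, L]` along the good orbit of `z`, then
`#T ≤ 1331 (d_j / ε + 1)`, `d_j = ∫₀ᴸ ‖v_j‖`, granted the packing bound `hpack` for `ε`-separated points of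
`𝕋³` in a ball (bucket argument along the path of `j`, see the module docstring). [folklore] -/
theorem snp_tubeCount_of_forall
    (hpack : ∀ {n : ℕ} {ε ρ : ℝ}, 0 < ε → 0 ≤ ρ → ∀ (x₀ : T3) (x : Fin n → T3) (I : Finset (Fin n)),
      (∀ i ∈ I, ∀ j ∈ I, i ≠ j → ε ≤ Torus.euclidDist (x i) (x j)) →
      (∀ i ∈ I, Torus.euclidDist (x i) x₀ ≤ ρ) → (I.card : ℝ) ≤ (2 * ρ / ε + 1) ^ 3)
    {N : ℕ} {ε : ℝ} (hε : 0 < ε)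
    (Φ : HardSphereFlow (Torus.geometry (Fin 3)) ε N) {z : Config N (Fin 3) T3} (hz : z ∈ Φ.good)
    {L : ℝ} (hL : 0 ≤ L) (j : Fin N) (T : Finset (Fin N))
    (hT : ∀ i ∈ T, (∫ t in (0 : ℝ)..L, ‖(Φ.flow t z i).2‖) ≤ ε ∧
        ∃ t ∈ Icc 0 L, ‖(Torus.geometry (Fin 3)).sepVec (Φ.flow t z i).1 (Φ.flow t z j).1‖ = ε) :
    (T.card : ℝ) ≤ 1331 * ((∫ t in (0 : ℝ)..L, ‖(Φ.flow t z j).2‖) / ε + 1) := by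
  have hwj := Φ.intervalIntegrable_norm_vel_flow hz j
  -- the contact times `tc i ∈ [0, L]` of the members `i ∈ T` with `j`
  have hch : ∀ i ∈ T, ∃ t ∈ Icc 0 L,
      ‖(Torus.geometry (Fin 3)).sepVec (Φ.flow t z i).1 (Φ.flow t z j).1‖ = ε := fun i hi => (hT i hi).2
  choose! tc htc1 htc2 using hch
  -- path length of `j` up to time `t`, and the bucket map
  set ℓ : ℝ → ℝ := fun t => ∫ u in (0 : ℝ)..t, ‖(Φ.flow u z j).2‖ with hℓ
  set b : Fin N → ℕ := fun i => ⌊ℓ (tc i) / ε⌋₊ with hb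
  -- (C) a member `i` starts within `2ε` of the point `x_j(tc i)` of the path of `j`
  have hC : ∀ i ∈ T, Torus.euclidDist (z i).1 (Φ.flow (tc i) z j).1 ≤ 2 * ε := by
    intro i hi
    have h1 : Torus.euclidDist (z i).1 (Φ.flow (tc i) z i).1 ≤ ε := by
      have h := Φ.euclidDist_flow_le_integral_norm_vel_of_mem_Icc₂ hz i ⟨le_rfl, hL⟩ (htc1 i hi)
      rw [Φ.flow_zero z hz] at h
      exact h.trans (hT i hi).1
    have h2 : Torus.euclidDist (Φ.flow (tc i) z i).1 (Φ.flow (tc i) z j).1 = ε := by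
      rw [← Torus.norm_geometry_sepVec]
      exact htc2 i hi
    calc Torus.euclidDist (z i).1 (Φ.flow (tc i) z j).1
        ≤ Torus.euclidDist (z i).1 (Φ.flow (tc i) z i).1 +
            Torus.euclidDist (Φ.flow (tc i) z i).1 (Φ.flow (tc i) z j).1 :=
          Literature.MathematicalPhysics.KineticTheory.torus_euclidDist_triangle _ _ _
      _ ≤ ε + ε := add_le_add h1 h2.le
      _ = 2 * ε := by ring
  -- (D) two members of one bucket touch `j` at points of its path at distance `≤ ε`
  have hD : ∀ i ∈ T, ∀ i' ∈ T, b i = b i' →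
      Torus.euclidDist (Φ.flow (tc i) z j).1 (Φ.flow (tc i') z j).1 ≤ ε := by
    intro i hi i' hi' hbb
    have hadd : ℓ (tc i') + ∫ u in tc i'..tc i, ‖(Φ.flow u z j).2‖ = ℓ (tc i) :=
      intervalIntegral.integral_add_adjacent_intervals (hwj 0 (tc i')) (hwj (tc i') (tc i))
    have hℓi : 0 ≤ ℓ (tc i) := Φ.integral_norm_vel_flow_nonneg z j (htc1 i hi).1
    have hℓi' : 0 ≤ ℓ (tc i') := Φ.integral_norm_vel_flow_nonneg z j (htc1 i' hi').1
    have h1 : ℓ (tc i) / ε < b i + 1 := Nat.lt_floor_add_one _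
    have h2 : (b i : ℝ) ≤ ℓ (tc i) / ε := Nat.floor_le (div_nonneg hℓi hε.le)
    have h3 : ℓ (tc i') / ε < b i' + 1 := Nat.lt_floor_add_one _
    have h4 : (b i' : ℝ) ≤ ℓ (tc i') / ε := Nat.floor_le (div_nonneg hℓi' hε.le)
    rw [hbb] at h1 h2
    have key : |ℓ (tc i) - ℓ (tc i')| < ε := by
      rw [abs_sub_lt_iff, ← div_lt_one hε, ← div_lt_one hε, sub_div, sub_div]
      constructor <;> linarith
    refine (Φ.euclidDist_flow_le_abs_integral_norm_vel hz j (tc i) (tc i')).trans ?_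
    rw [show (∫ u in tc i'..tc i, ‖(Φ.flow u z j).2‖) = ℓ (tc i) - ℓ (tc i') by linarith]
    exact key.le
  -- (A) a bucket has at most `1331` members: packing of the initial positions
  have hA : T.card ≤ 1331 * (T.image b).card := by
    refine Finset.card_le_mul_card_image T 1331 fun k hk => ?_
    obtain ⟨i₀, hi₀, hk⟩ := Finset.mem_image.1 hk
    rw [← Nat.cast_le (α := ℝ)]
    push_cast
    refine (hpack hε (by positivity : (0 : ℝ) ≤ 5 * ε) (z i₀).1 (fun i => (z i).1) _ ?_ ?_).trans ?_
    · intro i _ i' _ hne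
      rw [← Torus.norm_geometry_sepVec]
      exact mem_hardSphereDomain.1 (Φ.good_subset hz) i i' hne
    · intro i hi
      rw [Finset.mem_filter] at hi
      calc Torus.euclidDist (z i).1 (z i₀).1
          ≤ Torus.euclidDist (z i).1 (Φ.flow (tc i) z j).1 +
              Torus.euclidDist (Φ.flow (tc i) z j).1 (z i₀).1 :=
            Literature.MathematicalPhysics.KineticTheory.torus_euclidDist_triangle _ _ _
        _ ≤ Torus.euclidDist (z i).1 (Φ.flow (tc i) z j).1 +
              (Torus.euclidDist (Φ.flow (tc i) z j).1 (Φ.flow (tc i₀) z j).1 +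
                Torus.euclidDist (Φ.flow (tc i₀) z j).1 (z i₀).1) :=
            add_le_add le_rfl
              (Literature.MathematicalPhysics.KineticTheory.torus_euclidDist_triangle _ _ _)
        _ ≤ 2 * ε + (ε + 2 * ε) := by
            refine add_le_add (hC i hi.1) (add_le_add (hD i hi.1 i₀ hi₀ (hi.2.trans hk.symm)) ?_)
            rw [Torus.euclidDist_comm]
            exact hC i₀ hi₀
        _ = 5 * ε := by ring
    · have h10 : 2 * (5 * ε) / ε = 10 := by
        rw [div_eq_iff hε.ne']
        ring
      rw [h10]
      norm_num
  -- (B) the buckets range over `{0, …, ⌊d_j / ε⌋₊}`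
  have hB : T.image b ⊆ Finset.range (⌊(∫ u in (0 : ℝ)..L, ‖(Φ.flow u z j).2‖) / ε⌋₊ + 1) := by
    intro k hk
    obtain ⟨i, hi, rfl⟩ := Finset.mem_image.1 hk
    rw [Finset.mem_range, Nat.lt_add_one_iff]
    refine Nat.floor_le_floor (div_le_div_of_nonneg_right ?_ hε.le)
    exact Φ.integral_norm_vel_flow_mono hz j le_rfl (htc1 i hi).1 (htc1 i hi).2
  -- conclusion
  have hcardT : T.card ≤ 1331 * (⌊(∫ u in (0 : ℝ)..L, ‖(Φ.flow u z j).2‖) / ε⌋₊ + 1) :=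
    hA.trans (Nat.mul_le_mul_left _ ((Finset.card_le_card hB).trans (Finset.card_range _).le))
  have hdj : 0 ≤ (∫ u in (0 : ℝ)..L, ‖(Φ.flow u z j).2‖) / ε :=
    div_nonneg (Φ.integral_norm_vel_flow_nonneg z j hL) hε.le
  calc (T.card : ℝ) ≤ ((1331 * (⌊(∫ u in (0 : ℝ)..L, ‖(Φ.flow u z j).2‖) / ε⌋₊ + 1) : ℕ) : ℝ) := by
        exact_mod_cast hcardT
    _ = 1331 * ((⌊(∫ u in (0 : ℝ)..L, ‖(Φ.flow u z j).2‖) / ε⌋₊ : ℝ) + 1) := by push_cast; ring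
    _ ≤ 1331 * ((∫ u in (0 : ℝ)..L, ‖(Φ.flow u z j).2‖) / ε + 1) := by
        gcongr
        exact Nat.floor_le hdj

/-- **Tube count.** Along a good orbit of `N` hard spheres of diameter `ε` on `𝕋³`, the spheres `i ≠ j` of path
length `≤ r ≤ ε` over `[0, L]` ("tame") that come into contact with sphere `j` (separation exactly `ε`) at some
time of `[0, L]` number at most `1331 (d_j / ε + 1)`, where `d_j = ∫₀ᴸ ‖v_j‖` is the path length of `j`; the
packing bound for `ε`-separated points of `𝕋³` in a ball is the hypothesis `hpack`. [folklore] -/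
theorem snp_tubeCount :
    ∀ (hpack : ∀ {n : ℕ} {ε ρ : ℝ}, 0 < ε → 0 ≤ ρ → ∀ (x₀ : T3) (x : Fin n → T3) (I : Finset (Fin n)),
      (∀ i ∈ I, ∀ j ∈ I, i ≠ j → ε ≤ Torus.euclidDist (x i) (x j)) →
      (∀ i ∈ I, Torus.euclidDist (x i) x₀ ≤ ρ) → (I.card : ℝ) ≤ (2 * ρ / ε + 1) ^ 3)
    {N : ℕ} {ε : ℝ} (hε : 0 < ε)
    (Φ : HardSphereFlow (Torus.geometry (Fin 3)) ε N) {z : Config N (Fin 3) T3} (hz : z ∈ Φ.good)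
    {L r : ℝ} (hL : 0 ≤ L) (hr : 0 < r) (hrε : r ≤ ε) (j : Fin N),
    ((Finset.univ.filter fun i : Fin N => i ≠ j ∧ (∫ t in (0 : ℝ)..L, ‖(Φ.flow t z i).2‖) ≤ r ∧
        ∃ t ∈ Icc 0 L, ‖(Torus.geometry (Fin 3)).sepVec (Φ.flow t z i).1 (Φ.flow t z j).1‖ = ε).card : ℝ) ≤
      1331 * ((∫ t in (0 : ℝ)..L, ‖(Φ.flow t z j).2‖) / ε + 1) := by
  -- (the positivity `hr : 0 < r` of the tameness threshold is not needed)
  intro hpack N ε hε Φ z hz L r hL _ hrε j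
  refine snp_tubeCount_of_forall hpack hε Φ hz hL j _ fun i hi => ?_
  have h := (Finset.mem_filter.1 hi).2
  exact ⟨h.2.1.trans hrε, h.2.2⟩

end Summit.AtomisticToContinuum.HydrodynamicLimit.Theorems.ShotNoisePressure

end
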